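import Literature.NumberTheory.LFunctions.TuringMethodTuringBound
import Literature.NumberTheory.LFunctions.RiemannSiegelThetaBounds
import Literature.NumberTheory.LFunctions.LagariasXiPositivity
import HarnessLib

/-!
# Lagarias 1999, Theorem 1.3 — III: zeros near every height `t ≥ 90` (Lemma 3.5 by Turing's method)

Topic `Literature/NumberTheory/LFunctions`. Pure proof file (nothing is asserted, no definition): the
large-height half of **Lemma 3.5** of J. C. Lagarias, *On a positivity property of the Riemann
ξ-function*, Acta Arith. 89 (1999) — "for each `|t| ≥ 21` at least one of the following holds:
(i) there is a zero `ρ = β + iγ` of `ζ` with `|t − γ| ≤ 2`; (ii) there are two zeros (or a double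
zero) with `|t − γⱼ| ≤ 5`" — in the form used by the proof of
`Literature.NumberTheory.LFunctions.Lagarias1999_thm13`: for every `t ≥ 90` there is a zero with
ordinate in `(t − 2.35, t + 2.35]`, or there are zeros with ordinates in `(t − 5.2, t − 2.35]` and
in `(t + 2.35, t + 5.2]` (`exists_zeros_near`). (Lagarias proves this for `t ≥ 168π + 5` from
Turing's bound with `t₁ ≥ 168π` and reads the range `21 ≤ t ≤ 533` off a table of zeros; we lower
the threshold of Turing's bound to `80`, which the tree's proof of that bound allows at no cost,
and read only `21 ≤ t ≤ 90` off the kernel-certified table of `RiemannHypothesisUpTo101.lean`, in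
`LagariasXiPositivityTable.lean`.)

The argument is the printed one ((3.17)–(3.25) and p. 231):

* `abs_integral_zetaArgS_le_of_eighty_lt` — **Turing's bound from height `80`**:
  `|∫_{t₁}^{t₂} S(t) dt| ≤ 1.828 + 0.1212 log t₂` for `80 < t₁ ≤ t₂`, by the tree's assembly
  `Literature.NumberTheory.LFunctions.abs_integral_zetaArgS_le_of_bounds` of the two bounds for
  `∫_{1/2}^∞ log|ζ(σ+it)| dσ` (`setIntegral_Ioi_half_log_norm_riemannZeta_le_turing`, `c = 5/4`;
  `neg_setIntegral_Ioi_half_log_norm_riemannZeta_le'`, `d = 1`, Booker's lemma) with the threshold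
  `t₀ = 80` in place of `168π` (constants `a₁ ≤ 2.371`, `a₂ ≤ 3.369`, `(a₁+a₂)/π ≤ 1.828`,
  `(3/16 + (log 4 − 1)/2)/π ≤ 0.1212`). This replaces Lagarias's (3.23) (Turing–Lehman,
  `2.30 + 0.128 log(t₂/2π)` for `t₁ ≥ 168π`).
* `riemannSiegelTheta_sub_ge` — the slope of `θ`: `θ(b) − θ(a) ≥ (b − a)(½ log(u₀/2π) − 2/u₀)`
  for `1 ≤ u₀ ≤ a ≤ b` (`|θ'(u) − ½ log(u/2π)| ≤ 2/u`,
  `Literature.NumberTheory.LFunctions.abs_riemannSiegelThetaDeriv_sub_log_le`), replacing (3.19)–(3.20).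
* `sq_sub_lt_of_no_ordinate` — **(3.24)**: on an interval `(u, v]` free of ordinates of zeros,
  `S = N(u) − θ/π − 1` decreases at least at that slope; if `S(v) ≥ 0` or `S(u) ≤ 0` then `S` has
  one sign and `|∫_u^v S| ≥ slope·(v−u)²/(2π)`, so Turing's bound bounds `(v − u)²`.
* `exists_zeros_near` — **Lemma 3.5 for `t ≥ 90`** (p. 231): if `(t − 2.35, t + 2.35]` is free of
  ordinates, `S` changes sign there at a point `c` within `L − 2.35` of `t` (`L < 3.775` the bound
  of (3.24) at these heights, `key_numeric`), and an ordinate-free `(t − 5.2, c]` or `(c, t + 5.2]`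
  would be a one-signed stretch longer than `L`.

## References

* J. C. Lagarias, *On a positivity property of the Riemann ξ-function*, Acta Arith. 89 (1999),
  217–234, §3, Lemma 3.5, (3.17)–(3.25). [LagariasXiPositivity1999]
* H. M. Edwards, *Riemann's Zeta Function*, Academic Press 1974, §8.2 (Turing's method).
  [EdwardsZeta1974]
-/

noncomputable section

open Complex Real Set MeasureTheory intervalIntegral
open scoped Real

namespace Literature.NumberTheory.LFunctions

namespace Lagarias1999

/-! ### Turing's bound from height `80` -/

/-- `ε(80) ≤ 0.01006` (`ε` = `Literature.NumberTheory.LFunctions.turingEps`). [folklore] -/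
theorem turingEps_eighty_le : turingEps 80 ≤ 0.01006 := by
  unfold turingEps
  have hπ := Real.pi_lt_d6
  norm_num
  nlinarith

/-- `ε'(80) ≤ 0.01045` (`ε'` = `Literature.NumberTheory.LFunctions.turingEps'`). [folklore] -/
theorem turingEps'_eighty_le : turingEps' 80 ≤ 0.01045 := by
  unfold turingEps'
  have hπ := Real.pi_lt_d6
  norm_num
  nlinarith

/-- **`a₂(1, 80) ≤ 3.369`** (`a₂` = `Literature.NumberTheory.LFunctions.trudgianA₂`; as
`TuringBound.trudgianA₂_one_le` with `ε(80)`, `ε'(80)` in place of `ε(168π)`, `ε'(168π)`).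
[cite: Trudgian2011, Lemma 2.11] -/
theorem trudgianA₂_one_eighty_le : trudgianA₂ 1 80 ≤ 3.369 := by
  have hr : (-deriv riemannZeta ((1 / 2 + 1 : ℝ) : ℂ) / riemannZeta ((1 / 2 + 1 : ℝ) : ℂ)).re ≤
      1.573 := by
    rw [show (1 / 2 + 1 : ℝ) = 3 / 2 by norm_num]
    exact TuringBound.neg_logDeriv_riemannZeta_three_halves_le
  have hI := TuringBound.neg_turingI_one_le
  have hε := turingEps_eighty_le
  have hε' := turingEps'_eighty_le
  have hl2 := Real.log_two_gt_d9
  have hl2' := Real.log_two_lt_d9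
  have hlog4 : Real.log 4 = 2 * Real.log 2 := by
    rw [show (4 : ℝ) = 2 ^ 2 by norm_num, Real.log_pow]; norm_num
  have hL : 1.8378 ≤ Real.log 2 + Real.log π := by
    rw [← Real.log_mul (by norm_num) Real.pi_ne_zero]; exact TuringBound.le_log_two_pi
  have hprod : 0.3862943 * 0.9189 ≤ (Real.log 4 - 1) * (Real.log 2 / 2 + Real.log π / 2) :=
    mul_le_mul (by linarith) (by linarith) (by norm_num) (by linarith)
  have hX : Real.log 4 * ((-deriv riemannZeta ((1 / 2 + 1 : ℝ) : ℂ) /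
      riemannZeta ((1 / 2 + 1 : ℝ) : ℂ)).re + turingEps' 80) ≤ 1.3862944 * 1.58345 := by
    have h4 : Real.log 4 ≤ 1.3862944 := by linarith
    have h40 : 0 ≤ Real.log 4 := by linarith
    calc Real.log 4 * ((-deriv riemannZeta ((1 / 2 + 1 : ℝ) : ℂ) /
          riemannZeta ((1 / 2 + 1 : ℝ) : ℂ)).re + turingEps' 80)
        ≤ Real.log 4 * 1.58345 := mul_le_mul_of_nonneg_left (by linarith) h40
      _ ≤ 1.3862944 * 1.58345 := mul_le_mul_of_nonneg_right h4 (by norm_num)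
  unfold trudgianA₂
  nlinarith

/-- **The constant of the upper bound at `t₀ = 80`** (`c = 5/4`): `≤ 2.371`
(`m(5/4) ≤ 1.263`, `(3/8) log(4ζ(5/4)) ≤ 1.0986`, `(15/16)(45/4)²/(2·80²) ≤ 0.0093`). [folklore] -/
theorem turing_upper_constant_eighty_le :
    (∫ σ in Ioi (5 / 4 : ℝ), Real.log ‖riemannZeta σ‖) +
        (5 / 4 - 1 / 2) / 2 * Real.log (4 * (riemannZeta (5 / 4 : ℝ)).re) +
        (1 / 2 * ((5 / 4 - 1 / 2) / 2) + (5 / 4 - 1 / 2)) * ((10 + 5 / 4) ^ 2 / (2 * (80 : ℝ) ^ 2))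
      ≤ 2.371 := by
  have h1 := TuringBound.setIntegral_Ioi_log_norm_riemannZeta_five_quarters_le
  have h2 := TuringBound.log_four_mul_re_riemannZeta_five_quarters_le
  norm_num at h1 h2 ⊢
  linarith

/-- **Turing's bound from height `80`**: for `80 < t₁ ≤ t₂`,
`|∫_{t₁}^{t₂} S(t) dt| ≤ 1.828 + 0.1212 log t₂` (`S = Literature.NumberTheory.LFunctions.zetaArgS`).
The proof is that of `Literature.NumberTheory.LFunctions.abs_integral_zetaArgS_le_turing_holds`
(Turing 1953 / Lehman 1970 via Trudgian 2011, §2) with the threshold `168π` replaced by `80`.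
[cite: EdwardsZeta1974, §8.2 (1)] -/
theorem abs_integral_zetaArgS_le_of_eighty_lt {t₁ t₂ : ℝ} (h₁ : 80 < t₁) (h12 : t₁ ≤ t₂) :
    |∫ t in t₁..t₂, zetaArgS t| ≤ 1.828 + 0.1212 * Real.log t₂ := by
  have hπ := Real.pi_pos
  have hπ6 := Real.pi_gt_d6
  have ht₀ : (1 : ℝ) ≤ 80 := by norm_num
  obtain ⟨hb₂0, hb₂⟩ := TuringBound.trudgianB₂_one_bounds
  have h := abs_integral_zetaArgS_le_of_bounds (t₀ := 80) ht₀ (by norm_num) hb₂0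
    (fun t ht hord ↦ setIntegral_Ioi_half_log_norm_riemannZeta_le_turing (c := 5 / 4)
      (by norm_num) ht₀ ht hord)
    (fun t ht hord ↦ neg_setIntegral_Ioi_half_log_norm_riemannZeta_le'
      Trudgian2011_lemma_2_10_holds (d := 1) (by norm_num) le_rfl ht₀ ht hord) h₁ h12
  have ha₁ := turing_upper_constant_eighty_le
  have ha₂ := trudgianA₂_one_eighty_le
  have hA : ((∫ σ in Ioi (5 / 4 : ℝ), Real.log ‖riemannZeta σ‖) +
      (5 / 4 - 1 / 2) / 2 * Real.log (4 * (riemannZeta (5 / 4 : ℝ)).re) +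
      (1 / 2 * ((5 / 4 - 1 / 2) / 2) + (5 / 4 - 1 / 2)) * ((10 + 5 / 4) ^ 2 / (2 * (80 : ℝ) ^ 2)) +
      trudgianA₂ 1 80) / π ≤ 1.828 := by
    rw [div_le_iff₀ hπ]; linarith
  have hB : (1 / 2 * ((5 / 4 - 1 / 2) / 2) + trudgianB₂ 1) / π ≤ 0.1212 := by
    rw [div_le_iff₀ hπ]; norm_num; linarith
  have hlog : 0 ≤ Real.log t₂ := Real.log_nonneg (by linarith)
  nlinarith [mul_le_mul_of_nonneg_right hB hlog]

/-! ### The slope of `θ` -/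

/-- **The slope of `θ`** (replacing (3.19)–(3.20)): for `1 ≤ u₀ ≤ a ≤ b`,
`(½ log(u₀/2π) − 2/u₀)(b − a) ≤ θ(b) − θ(a)`, since `θ' ≥ ½ log(u/2π) − 2/u`
(`Literature.NumberTheory.LFunctions.abs_riemannSiegelThetaDeriv_sub_log_le`) and the right side
increases with `u`. [cite: LagariasXiPositivity1999, (3.19)–(3.20)] -/
theorem riemannSiegelTheta_sub_ge {u₀ a b : ℝ} (hu₀ : 1 ≤ u₀) (ha : u₀ ≤ a) (hab : a ≤ b) :
    (Real.log (u₀ / (2 * π)) / 2 - 2 / u₀) * (b - a) ≤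
      riemannSiegelTheta b - riemannSiegelTheta a := by
  have hcont := continuous_riemannSiegelThetaDeriv_holds
  have hint : ∀ x y : ℝ, IntervalIntegrable riemannSiegelThetaDeriv volume x y := fun x y ↦
    hcont.intervalIntegrable x y
  have hsub : riemannSiegelTheta b - riemannSiegelTheta a = ∫ u in a..b, riemannSiegelThetaDeriv u := by
    simp only [riemannSiegelTheta]
    rw [intervalIntegral.integral_interval_sub_left (hint 0 b) (hint 0 a)]
  rw [hsub]
  have hπ := Real.pi_pos
  have hu₀0 : 0 < u₀ := by linarith
  have hmono := intervalIntegral.integral_mono_on hab intervalIntegrable_const (hint a b)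
    (f := fun _ ↦ Real.log (u₀ / (2 * π)) / 2 - 2 / u₀) (fun u hu ↦ ?_)
  · rwa [intervalIntegral.integral_const, smul_eq_mul, mul_comm] at hmono
  · have hu1 : 1 ≤ u := by linarith [hu.1]
    have hu0 : 0 < u := by linarith
    have h := (abs_le.1 (abs_riemannSiegelThetaDeriv_sub_log_le hu1)).1
    have hlog : Real.log (u₀ / (2 * π)) ≤ Real.log (u / (2 * π)) :=
      Real.log_le_log (by positivity) (by gcongr; linarith [hu.1])
    have hinv : 2 / u ≤ 2 / u₀ := div_le_div_of_nonneg_left (by norm_num) hu₀0 (by linarith [hu.1])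
    linarith

/-! ### (3.24): ordinate-free one-signed stretches of `S` are short -/

/-- `∫_u^v (v − w) dw = (v − u)²/2`. [folklore] -/
theorem integral_sub_right (u v : ℝ) : ∫ w in u..v, (v - w) = (v - u) ^ 2 / 2 := by
  have h := intervalIntegral.integral_sub (f := fun _ : ℝ ↦ v) (g := fun w : ℝ ↦ w) (μ := volume)
    (a := u) (b := v) intervalIntegrable_const (continuous_id'.intervalIntegrable _ _)
  rw [h, intervalIntegral.integral_const, integral_id, smul_eq_mul]
  ring

/-- `∫_u^v (w − u) dw = (v − u)²/2`. [folklore] -/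
theorem integral_sub_left (u v : ℝ) : ∫ w in u..v, (w - u) = (v - u) ^ 2 / 2 := by
  have h := intervalIntegral.integral_sub (f := fun w : ℝ ↦ w) (g := fun _ : ℝ ↦ u) (μ := volume)
    (a := u) (b := v) (continuous_id'.intervalIntegrable _ _) intervalIntegrable_const
  rw [h, intervalIntegral.integral_const, integral_id, smul_eq_mul]
  ring

/-- `½ log(u₀/2π) − 2/u₀ > 0.9` for `u₀ > 80` (`log(80/2π) > 2`). [folklore] -/
theorem slope_pos {u₀ : ℝ} (hu₀ : 80 < u₀) : 0.9 < Real.log (u₀ / (2 * π)) / 2 - 2 / u₀ := by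
  have hπ := Real.pi_lt_d6
  have hπ0 := Real.pi_pos
  have h2 : (2 : ℝ) ≤ Real.log (u₀ / (2 * π)) := by
    rw [Real.le_log_iff_exp_le (by positivity)]
    have he := Real.exp_one_lt_d9
    have h1 : Real.exp 2 = Real.exp 1 ^ 2 := by rw [← Real.exp_nat_mul]; norm_num
    rw [h1, le_div_iff₀ (by positivity)]
    nlinarith [Real.exp_pos 1]
  have h3 : 2 / u₀ ≤ 2 / 80 := div_le_div_of_nonneg_left (by norm_num) (by norm_num) hu₀.le
  linarith

/-- **(3.24), quantitative**: let `80 < u₀ ≤ u < v ≤ V`, suppose no zero of `ζ` has ordinate in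
`(u, v]`, and `S(v) ≥ 0` or `S(u) ≤ 0` (so that `S = N(u) − θ/π − 1` has one sign on `(u, v)`).
Then `slope(u₀)·(v − u)²/(2π) ≤ |∫_u^v S| ≤ 1.828 + 0.1212 log V`; hence if
`2π(1.828 + 0.1212 log V) < slope(u₀)·D` then `(v − u)² < D`.
[cite: LagariasXiPositivity1999, (3.24)–(3.25)] -/
theorem sq_sub_lt_of_no_ordinate {u₀ u v V D : ℝ} (hu₀ : 80 < u₀) (hu : u₀ ≤ u) (huv : u < v)
    (hvV : v ≤ V) (hno : ∀ ρ : ℂ, riemannZeta ρ = 0 → ¬(u < ρ.im ∧ ρ.im ≤ v))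
    (hsign : 0 ≤ zetaArgS v ∨ zetaArgS u ≤ 0)
    (hK : 2 * π * (1.828 + 0.1212 * Real.log V) < (Real.log (u₀ / (2 * π)) / 2 - 2 / u₀) * D) :
    (v - u) ^ 2 < D := by
  have hπ := Real.pi_pos
  set m : ℝ := Real.log (u₀ / (2 * π)) / 2 - 2 / u₀ with hm_def
  have hm : 0 < m := lt_trans (by norm_num) (slope_pos hu₀)
  -- `N` is constant on `[u, v]`, so `S = N(u) − θ/π − 1` there
  have hS : ∀ w ∈ Icc u v, zetaArgS w = zetaZeroCount u - riemannSiegelTheta w / π - 1 := by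
    intro w hw
    unfold zetaArgS
    rw [zetaZeroCount_eq_of_no_ordinate hw.1 (fun ρ hρ h ↦ hno ρ hρ ⟨h.1, h.2.trans hw.2⟩)]
  -- Turing's bound
  have hI := abs_integral_zetaArgS_le_of_eighty_lt (t₁ := u) (by linarith) huv.le
  have hlogV : Real.log v ≤ Real.log V := Real.log_le_log (by linarith) hvV
  have hB : |∫ t in u..v, zetaArgS t| ≤ 1.828 + 0.1212 * Real.log V := by nlinarith
  -- the one-signed lower bound for `|∫ S|`
  have hlow : m * (v - u) ^ 2 / (2 * π) ≤ |∫ t in u..v, zetaArgS t| := by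
    have hintS := intervalIntegrable_zetaArgS u v
    rcases hsign with hv0 | hu0
    · -- `S(w) ≥ m (v − w)/π` on `[u, v]`
      have hpt : ∀ w ∈ Icc u v, m / π * (v - w) ≤ zetaArgS w := by
        intro w hw
        have hθ := riemannSiegelTheta_sub_ge (by linarith : (1 : ℝ) ≤ u₀) (by linarith [hw.1]) hw.2
        rw [← hm_def] at hθ
        rw [hS w hw]
        rw [hS v ⟨huv.le, le_rfl⟩] at hv0
        have e : m / π * (v - w) = (m * (v - w)) / π := by ring
        have h1 : m * (v - w) / π ≤ (riemannSiegelTheta v - riemannSiegelTheta w) / π :=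
          div_le_div_of_nonneg_right hθ hπ.le
        have e2 : (zetaZeroCount u : ℝ) - riemannSiegelTheta w / π - 1 =
            ((zetaZeroCount u : ℝ) - riemannSiegelTheta v / π - 1) +
              (riemannSiegelTheta v - riemannSiegelTheta w) / π := by ring
        rw [e, e2]
        linarith
      have hmono := intervalIntegral.integral_mono_on huv.le (f := fun w ↦ m / π * (v - w))
        (Continuous.intervalIntegrable (by fun_prop) _ _) hintS hpt
      rw [intervalIntegral.integral_const_mul, integral_sub_right] at hmono
      have e : m / π * ((v - u) ^ 2 / 2) = m * (v - u) ^ 2 / (2 * π) := by ring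
      rw [e] at hmono
      exact hmono.trans (le_abs_self _)
    · -- `S(w) ≤ −m (w − u)/π` on `[u, v]`
      have hpt : ∀ w ∈ Icc u v, zetaArgS w ≤ -(m / π) * (w - u) := by
        intro w hw
        have hθ := riemannSiegelTheta_sub_ge (by linarith : (1 : ℝ) ≤ u₀) hu hw.1
        rw [← hm_def] at hθ
        rw [hS w hw]
        rw [hS u ⟨le_rfl, huv.le⟩] at hu0
        have e : -(m / π) * (w - u) = -((m * (w - u)) / π) := by ring
        have h1 : m * (w - u) / π ≤ (riemannSiegelTheta w - riemannSiegelTheta u) / π :=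
          div_le_div_of_nonneg_right hθ hπ.le
        have e2 : (zetaZeroCount u : ℝ) - riemannSiegelTheta w / π - 1 =
            ((zetaZeroCount u : ℝ) - riemannSiegelTheta u / π - 1) -
              (riemannSiegelTheta w - riemannSiegelTheta u) / π := by ring
        rw [e, e2]
        linarith
      have hmono := intervalIntegral.integral_mono_on huv.le (g := fun w ↦ -(m / π) * (w - u)) hintS
        (Continuous.intervalIntegrable (by fun_prop) _ _) hpt
      rw [intervalIntegral.integral_const_mul, integral_sub_left] at hmono
      have e : -(m / π) * ((v - u) ^ 2 / 2) = -(m * (v - u) ^ 2 / (2 * π)) := by ring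
      rw [e] at hmono
      have := neg_abs_le (∫ t in u..v, zetaArgS t)
      linarith
  -- compare
  have h1 : m * (v - u) ^ 2 ≤ 2 * π * (1.828 + 0.1212 * Real.log V) := by
    have := hlow.trans hB
    rw [div_le_iff₀ (by positivity)] at this
    linarith
  have h2 : m * (v - u) ^ 2 < m * D := by linarith
  exact lt_of_mul_lt_mul_left h2 hm.le

/-! ### Lemma 3.5 for `t ≥ 90` -/

/-- `4.4 ≤ log 84.8` (`e^{4.4} = 81.45… ≤ 84.8`). [folklore] -/
theorem le_log_848 : 4.4 ≤ Real.log 84.8 := by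
  rw [Real.le_log_iff_exp_le (by norm_num)]
  have h1 : Real.exp 4.4 = Real.exp 1 ^ 4 * Real.exp 0.4 := by
    rw [← Real.exp_nat_mul, ← Real.exp_add]; norm_num
  have he := Real.exp_one_lt_d9
  have he0 := Real.exp_pos 1
  have hb := Real.exp_bound' (x := 0.4) (by norm_num) (by norm_num) (n := 10) (by norm_num)
  have hb' : Real.exp 0.4 ≤ 1.4918247 :=
    hb.trans (by norm_num [Finset.sum_range_succ, Nat.factorial])
  have h4 : Real.exp 1 ^ 4 ≤ 2.7182818286 ^ 4 := by gcongr
  rw [h1]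
  nlinarith [Real.exp_pos 0.4, pow_pos he0 4]

/-- `log(119/106) ≤ 0.116`. [folklore] -/
theorem log_ratio_le : Real.log (119 / 106) ≤ 0.116 := by
  refine (Real.log_le_iff_le_exp (by norm_num)).2 ?_
  refine le_trans ?_ (Real.sum_le_exp_of_nonneg (by norm_num) 4)
  norm_num [Finset.sum_range_succ, Nat.factorial]

/-- **The numerical heart of Lemma 3.5 at heights `≥ 90`**: for `t ≥ 90`,
`2π(1.828 + 0.1212 log(t + 5.2)) < (½ log((t − 5.2)/2π) − 2/(t − 5.2)) · 3.775²`, i.e. the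
bound `L` of (3.24) for stretches inside `[t − 5.2, t + 5.2]` satisfies `L < 3.775 = (2.35 + 5.2)/2`
(at `t = 90`: `L = 3.42…`; Lagarias at `t ≥ 168π`: `L ≤ 10/3 < (2 + 5)/2`).
[cite: LagariasXiPositivity1999, (3.24)–(3.25)] -/
theorem key_numeric {t : ℝ} (ht : 90 ≤ t) :
    2 * π * (1.828 + 0.1212 * Real.log (t + 26 / 5)) <
      (Real.log ((t - 26 / 5) / (2 * π)) / 2 - 2 / (t - 26 / 5)) * (151 / 40) ^ 2 := by
  have hπ := Real.pi_pos
  have hπ' := Real.pi_lt_d6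
  set x : ℝ := Real.log (t - 26 / 5) with hx_def
  have ht5 : 84.8 ≤ t - 26 / 5 := by linarith
  have hx : 4.4 ≤ x := le_log_848.trans (Real.log_le_log (by norm_num) ht5)
  -- `log(t + 5.2) ≤ x + 0.116`
  have hV : Real.log (t + 26 / 5) ≤ x + 0.116 := by
    have hratio : (t + 26 / 5) / (t - 26 / 5) ≤ 119 / 106 := by
      rw [div_le_div_iff₀ (by linarith) (by norm_num)]; linarith
    have hlog : Real.log ((t + 26 / 5) / (t - 26 / 5)) ≤ 0.116 :=
      (Real.log_le_log (by positivity) hratio).trans log_ratio_le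
    rw [Real.log_div (by linarith) (by linarith)] at hlog
    linarith
  -- the slope
  have hm : (x - 1.8379) / 2 - 0.0236 ≤ Real.log ((t - 26 / 5) / (2 * π)) / 2 - 2 / (t - 26 / 5) := by
    rw [Real.log_div (by linarith) (by positivity)]
    -- `log(2π) ≤ 1.8379` (as in `SchoenfeldMid.log_two_pi_le`, not imported here)
    have h2π : Real.log (2 * π) ≤ 1.8379 := by
      have hle : 2 * π ≤ 6.283186 := by linarith
      exact (Real.log_le_iff_le_exp (by positivity)).2 ((hle.trans (by norm_num
        [Finset.sum_range_succ, Nat.factorial])).trans (Real.sum_le_exp_of_nonneg (by norm_num) 14))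
    have hinv : 2 / (t - 26 / 5) ≤ 0.0236 := by
      rw [div_le_iff₀ (by linarith)]; linarith
    linarith
  -- the left side
  have hlogV0 : 0 ≤ Real.log (t + 26 / 5) := Real.log_nonneg (by linarith)
  have hL : 2 * π * (1.828 + 0.1212 * Real.log (t + 26 / 5)) ≤
      2 * 3.141593 * (1.828 + 0.1212 * (x + 0.116)) := by
    have h0 : 0 ≤ 1.828 + 0.1212 * Real.log (t + 26 / 5) := by positivity
    calc 2 * π * (1.828 + 0.1212 * Real.log (t + 26 / 5))
        ≤ 2 * 3.141593 * (1.828 + 0.1212 * Real.log (t + 26 / 5)) := by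
          apply mul_le_mul_of_nonneg_right _ h0; linarith
      _ ≤ 2 * 3.141593 * (1.828 + 0.1212 * (x + 0.116)) := by
          apply mul_le_mul_of_nonneg_left _ (by norm_num); linarith
  nlinarith

/-- `S` changes sign on an ordinate-free interval `[u, v]` on which `S(u) > 0 > S(v)`: there is
`c ∈ (u, v)` with `S(c) = 0` (`S = N(u) − θ/π − 1` is continuous there). [folklore] -/
theorem exists_zetaArgS_eq_zero {u v : ℝ} (huv : u ≤ v)
    (hno : ∀ ρ : ℂ, riemannZeta ρ = 0 → ¬(u < ρ.im ∧ ρ.im ≤ v))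
    (hu : 0 < zetaArgS u) (hv : zetaArgS v < 0) :
    ∃ c, u < c ∧ c < v ∧ zetaArgS c = 0 := by
  have hS : ∀ w ∈ Icc u v, zetaArgS w = zetaZeroCount u - riemannSiegelTheta w / π - 1 := by
    intro w hw
    unfold zetaArgS
    rw [zetaZeroCount_eq_of_no_ordinate hw.1 (fun ρ hρ h ↦ hno ρ hρ ⟨h.1, h.2.trans hw.2⟩)]
  set g : ℝ → ℝ := fun w ↦ zetaZeroCount u - riemannSiegelTheta w / π - 1 with hg
  have hgc : Continuous g := by
    simp only [hg]
    exact (continuous_const.sub (continuous_riemannSiegelTheta.div_const _)).sub continuous_const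
  have hgu : g u = zetaArgS u := (hS u ⟨le_rfl, huv⟩).symm
  have hgv : g v = zetaArgS v := (hS v ⟨huv, le_rfl⟩).symm
  have h0 : (0 : ℝ) ∈ Icc (g v) (g u) := ⟨by rw [hgv]; exact hv.le, by rw [hgu]; exact hu.le⟩
  obtain ⟨c, hc, hgc0⟩ := intermediate_value_Icc' huv hgc.continuousOn h0
  have hSc : zetaArgS c = 0 := by rw [hS c hc]; exact hgc0
  refine ⟨c, lt_of_le_of_ne hc.1 ?_, lt_of_le_of_ne hc.2 ?_, hSc⟩
  · rintro rfl; linarith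
  · rintro rfl; linarith

/-- **Lemma 3.5 at heights `t ≥ 90`** (Lagarias: every `|t| ≥ 21` is within `2` of an ordinate
of a zero of `ζ` or within `5` of two of them; here with `2.35`, `5.2` and one-sided windows):
for `t ≥ 90`, either some zero `ρ` of `ζ` has `t − 2.35 < Im ρ ≤ t + 2.35`, or there are zeros
`ρ₁`, `ρ₂` with `t − 5.2 < Im ρ₁ ≤ t − 2.35` and `t + 2.35 < Im ρ₂ ≤ t + 5.2`. Unconditional.
[cite: LagariasXiPositivity1999, Lemma 3.5] -/
theorem exists_zeros_near {t : ℝ} (ht : 90 ≤ t) :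
    (∃ ρ : ℂ, riemannZeta ρ = 0 ∧ t - 47 / 20 < ρ.im ∧ ρ.im ≤ t + 47 / 20) ∨
      ((∃ ρ : ℂ, riemannZeta ρ = 0 ∧ t - 26 / 5 < ρ.im ∧ ρ.im ≤ t - 47 / 20) ∧
        (∃ ρ : ℂ, riemannZeta ρ = 0 ∧ t + 47 / 20 < ρ.im ∧ ρ.im ≤ t + 26 / 5)) := by
  by_cases h1 : ∃ ρ : ℂ, riemannZeta ρ = 0 ∧ t - 47 / 20 < ρ.im ∧ ρ.im ≤ t + 47 / 20
  · exact Or.inl h1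
  right
  push Not at h1
  have hK := key_numeric ht
  have hu₀ : 80 < t - 26 / 5 := by linarith
  -- no ordinates in `(t − 2.35, t + 2.35]`
  have hno₁ : ∀ ρ : ℂ, riemannZeta ρ = 0 → ¬(t - 47 / 20 < ρ.im ∧ ρ.im ≤ t + 47 / 20) :=
    fun ρ hρ h ↦ absurd h.2 (not_le.2 (h1 ρ hρ h.1))
  -- (α), (β): `S(t + 2.35) < 0 < S(t − 2.35)`
  have hα : zetaArgS (t + 47 / 20) < 0 := by
    by_contra h
    have := sq_sub_lt_of_no_ordinate hu₀ (u := t - 47 / 20) (v := t + 47 / 20) (V := t + 26 / 5)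
      (by linarith) (by linarith) (by linarith) hno₁ (Or.inl (not_lt.1 h)) hK
    norm_num at this
  have hβ : 0 < zetaArgS (t - 47 / 20) := by
    by_contra h
    have := sq_sub_lt_of_no_ordinate hu₀ (u := t - 47 / 20) (v := t + 47 / 20) (V := t + 26 / 5)
      (by linarith) (by linarith) (by linarith) hno₁ (Or.inr (not_lt.1 h)) hK
    norm_num at this
  -- the sign change `c`
  obtain ⟨c, hcu, hcv, hSc⟩ := exists_zetaArgS_eq_zero (by linarith) hno₁ hβ hα
  -- (γ): both pieces are shorter than `3.775`
  have hγ₁ := sq_sub_lt_of_no_ordinate hu₀ (u := t - 47 / 20) (v := c) (V := t + 26 / 5)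
    (by linarith) hcu (by linarith) (fun ρ hρ h ↦ hno₁ ρ hρ ⟨h.1, h.2.trans hcv.le⟩)
    (Or.inl hSc.ge) hK
  have hγ₂ := sq_sub_lt_of_no_ordinate hu₀ (u := c) (v := t + 47 / 20) (V := t + 26 / 5)
    (by linarith) hcv (by linarith) (fun ρ hρ h ↦ hno₁ ρ hρ ⟨hcu.trans h.1, h.2⟩)
    (Or.inr hSc.le) hK
  have hc₁ : c < t - 47 / 20 + 151 / 40 := by nlinarith
  have hc₂ : t + 47 / 20 - 151 / 40 < c := by nlinarith
  constructor
  · -- (δ): a zero in `(t − 5.2, t − 2.35]`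
    by_contra h2
    push Not at h2
    have hno : ∀ ρ : ℂ, riemannZeta ρ = 0 → ¬(t - 26 / 5 < ρ.im ∧ ρ.im ≤ c) := by
      intro ρ hρ h
      rcases le_or_gt ρ.im (t - 47 / 20) with h3 | h3
      · exact absurd h3 (not_le.2 (h2 ρ hρ h.1))
      · exact hno₁ ρ hρ ⟨h3, h.2.trans hcv.le⟩
    have hδ := sq_sub_lt_of_no_ordinate hu₀ (u := t - 26 / 5) (v := c) (V := t + 26 / 5)
      le_rfl (by linarith) (by linarith) hno (Or.inl hSc.ge) hK
    nlinarith
  · -- (ε): a zero in `(t + 2.35, t + 5.2]`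
    by_contra h3
    push Not at h3
    have hno : ∀ ρ : ℂ, riemannZeta ρ = 0 → ¬(c < ρ.im ∧ ρ.im ≤ t + 26 / 5) := by
      intro ρ hρ h
      rcases le_or_gt ρ.im (t + 47 / 20) with h4 | h4
      · exact hno₁ ρ hρ ⟨hcu.trans h.1, h4⟩
      · exact absurd h.2 (not_le.2 (h3 ρ hρ h4))
    have hε := sq_sub_lt_of_no_ordinate hu₀ (u := c) (v := t + 26 / 5) (V := t + 26 / 5)
      (by linarith) (by linarith) le_rfl hno (Or.inr hSc.le) hK
    nlinarith

end Lagarias1999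

end Literature.NumberTheory.LFunctions

end
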